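import Literature.MathematicalPhysics.QuantumLattice.SourcedGroundStatePairLROFloor
import Literature.MathematicalPhysics.QuantumLattice.DWaveSymmetricGroundStateLRO
import HarnessLib

/-!
# The pair-LRO CEILING of translation-invariant ground states of the pair-sourced `t–t'` Hubbard model
# (statement), and what follows from it: the zero-field ceiling `(m⋆)²`, the SHARP infinite-volume Koma–Tasaki
# identity, and `k = 0` clustering at `h > 0`

Topic `Literature/MathematicalPhysics/QuantumLattice` (namespace = path; family `hubbard`). These are items (C) of
`hubbard-cq-lens-transplant-1` g4's `TransplantSketch4.lean` (DICTIONARY §12), landed as is for the Hubbard cuprate cell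
(`hubbard-cq`; lead ACKS 91 (2)), next to `SourcedGroundStatePairLROFloor.lean` (item (F): the floor `(∂⁻E(h)/2)²`)
and `DWaveSymmetricGroundStateLRO.lean` (hubbard-cq-p4: a gauge-invariant translation-invariant ground state with box
pair LRO `≥ (m⋆)²`). Notation: `E = dWaveSourceEnergyDensityTT' t' U μ`, `Ψ_h = hubbardTTPrimeSourcedInteraction 1 t' U μ
dWaveFormFactor h` (`Ψ_0 = hubbardTTPrimeMuInteraction 1 t' U μ`), `m⋆ = dWaveOrderParameterTT' t' U μ = −∂⁺E(0)/2`,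
`boxLRO_N(ω) = Re N⁻⁴ Σ_{x,y∈[0,N)²} ω(P_x^d⋆ P_y^d)`.

* `TIGroundStatePairLROCeiling t' U μ` (STATEMENT, a named Prop, NOT proved here): for `h ≥ 0` every
  translation-invariant ground state `ω` of `Ψ_h` has `limsup_N boxLRO_N(ω) ≤ (∂⁺E(h)/2)²` (ε–eventually form).
  This is the infinite-volume translation-invariant form of Koma–Tasaki's Theorem 7.3 (torus ground states) /
  Bogoliubov Jr.'s approximating-Hamiltonian bound; the sketch's proof chain (α)–(η) (zero-temperature AHM bound with
  the locality constants of the torus pair field, complex sources by gauge rotation, concavity, torus restriction of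
  the minimiser, `L → ∞`, `r → 0`, `g → 0`) is recorded in `TransplantSketch4.lean` and is NOT typed; every theorem
  below takes the ceiling as a HYPOTHESIS (conditional results).
* `ZeroFieldPairLROCeiling t' U μ` and `zeroFieldPairLROCeiling_of_ceiling`: at `h = 0` the ceiling reads
  `limsup_N boxLRO_N(ω) ≤ (m⋆)²` for EVERY translation-invariant ground state of `Ψ_0`.
* `sharpKomaTasaki_of_ceiling`: with p4's symmetric LRO state, `max_{TI GS} limsup_N boxLRO_N = (m⋆)²`, attained by
  a GAUGE-INVARIANT ground state — response ⇔ LRO with EQUALITY in the infinite-volume translation-invariant class.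
* `clustering_of_ceiling`: at `h > 0` where `E'(h) = e'` exists, every translation-invariant ground state of `Ψ_h`
  has REAL pair amplitude `ω(P₀^d) = −e'/2` and `boxLRO_N(ω) → (e'/2)²` (the finite-`h` LRO word is the response
  word squared — transplant-1's BN-T5).
* UNCONDITIONAL (hubbard-cq-critic-1's named lemma): `IsMeanEnergyMinimiser.re_expect_localPairAt_nonneg` — at `h > 0`
  every translation-invariant ground state has `0 ≤ Re ω(P₀^d)` (`−∂⁻E(h) ≤ 2Re ω(P₀^d)` and `∂⁻E(h) ≤ 0`).

HONEST SCOPE: T5-class dictionary statements about INFINITE-VOLUME translation-invariant ground states; conditional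
on the named ceiling except where marked; no bearing on torus ground states (transplant-1 census (24)/(44)); no CQ
bit; nothing here floors `d`-wave order.

## References
* T. Koma, H. Tasaki, Commun. Math. Phys. 158 (1993) 191, Thm. 7.3 (order parameter under an infinitesimal field
  bounds the LRO of symmetric ground states). [cite: KomaTasaki1993, Theorem 7.3]
* N. N. Bogoliubov Jr., Physica 32 (1966) 933, Thm. 1 (approximating Hamiltonian). [cite: BogolyubovJr1966, Thm 1]
* T. Koma, H. Tasaki, J. Stat. Phys. 76 (1994) 745–803, §1. [cite: KomaTasaki1994, §1]
* R. B. Griffiths, Phys. Rev. 152 (1966) 240, §II. [cite: Griffiths1966, §II]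
-/

noncomputable section

namespace Literature.MathematicalPhysics.QuantumLattice

open _root_.Matrix Finset Complex Literature.Probability.LatticeModels _root_.Filter Set
open scoped _root_.Topology ComplexOrder

/-! ### The ceiling (statement) and the zero-field form -/

/-- **CEILING** (statement). For `h ≥ 0`, every translation-invariant ground state `ω` of `Ψ_h` has
`limsup_N boxLRO_N(ω) ≤ (∂⁺E(h)/2)²`, in the junk-free form `∀ ε > 0, eventually boxLRO_N(ω) ≤ (∂⁺E(h)/2)² + ε` —
Koma–Tasaki's Theorem 7.3 in the infinite-volume translation-invariant class.
-- TODO(general form): Koma–Tasaki prove the torus-ground-state version; the translation-invariant infinite-volume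
-- version follows by transplant-1's chain (α)–(η) of `TransplantSketch4.lean`, not yet typed.
[cite: KomaTasaki1993, Theorem 7.3] -/
def TIGroundStatePairLROCeiling (t' U μ : ℝ) : Prop :=
  ∀ ⦃h : ℝ⦄, 0 ≤ h → ∀ ⦃ω : InfVolFermionState 2⦄,
    ω.IsMeanEnergyMinimiser (hubbardTTPrimeSourcedInteraction 1 t' U μ dWaveFormFactor h) 1 →
    ∀ ε : ℝ, 0 < ε → ∀ᶠ N : ℕ in atTop,
      (((N : ℂ) ^ 4)⁻¹ * ∑ x ∈ halfOpenBox 2 N, ∑ y ∈ halfOpenBox 2 N, ω.dWavePairCorr x y).re ≤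
        (derivWithin (dWaveSourceEnergyDensityTT' t' U μ) (Ioi h) h / 2) ^ 2 + ε

/-- **ZERO-FIELD CEILING** (statement): every translation-invariant ground state of the grand-canonical `t–t'`
interaction has asymptotic box pair LRO at most `(m⋆)²`. [cite: KomaTasaki1993, Theorem 7.3] -/
def ZeroFieldPairLROCeiling (t' U μ : ℝ) : Prop :=
  ∀ ⦃ω : InfVolFermionState 2⦄, ω.IsMeanEnergyMinimiser (hubbardTTPrimeMuInteraction 1 t' U μ) 1 →
    ∀ ε : ℝ, 0 < ε → ∀ᶠ N : ℕ in atTop,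
      (((N : ℂ) ^ 4)⁻¹ * ∑ x ∈ halfOpenBox 2 N, ∑ y ∈ halfOpenBox 2 N, ω.dWavePairCorr x y).re ≤
        dWaveOrderParameterTT' t' U μ ^ 2 + ε

/-- The ceiling at `h = 0` IS the zero-field ceiling (`m⋆ = −∂⁺E(0)/2`, `Ψ_0 = hubbardTTPrimeMuInteraction`).
[cite: KomaTasaki1994, §1] -/
theorem zeroFieldPairLROCeiling_of_ceiling {t' U μ : ℝ} (hC : TIGroundStatePairLROCeiling t' U μ) :
    ZeroFieldPairLROCeiling t' U μ := by
  intro ω hω ε hε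
  have hω' : ω.IsMeanEnergyMinimiser (hubbardTTPrimeSourcedInteraction 1 t' U μ dWaveFormFactor 0) 1 := by
    rwa [hubbardTTPrimeSourcedInteraction_zero_source]
  have hsq : (derivWithin (dWaveSourceEnergyDensityTT' t' U μ) (Ioi 0) 0 / 2) ^ 2 =
      dWaveOrderParameterTT' t' U μ ^ 2 := by
    rw [dWaveOrderParameterTT'_eq_neg_half_rightDeriv]; ring
  filter_upwards [hC le_rfl hω' ε hε] with N hN
  rwa [hsq] at hN

/-- **THE SHARP INFINITE-VOLUME KOMA–TASAKI IDENTITY, modulo the ceiling**: `(m⋆)²` bounds the asymptotic box pair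
LRO of EVERY translation-invariant ground state from above, and is attained (uniformly in the box) by a
GAUGE-INVARIANT one — `max_ω limsup_N boxLRO_N(ω) = (m⋆)²`. [cite: KomaTasaki1993, Theorem 7.3] -/
theorem sharpKomaTasaki_of_ceiling {t' U μ : ℝ} (hC : TIGroundStatePairLROCeiling t' U μ) :
    ZeroFieldPairLROCeiling t' U μ ∧
      ∃ ω : InfVolFermionState 2, ω.IsMeanEnergyMinimiser (hubbardTTPrimeMuInteraction 1 t' U μ) 1 ∧
        ω.IsGaugeInvariant ∧ ∀ N : ℕ, N ≠ 0 → dWaveOrderParameterTT' t' U μ ^ 2 ≤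
          (((N : ℂ) ^ 4)⁻¹ * ∑ x ∈ halfOpenBox 2 N, ∑ y ∈ halfOpenBox 2 N, ω.dWavePairCorr x y).re := by
  obtain ⟨ω, hω, hG, -, hL⟩ :=
    exists_gaugeInvariant_isMeanEnergyMinimiser_dWaveOrderParameterTT'_sq_le_re_boxAverage t' U μ
  exact ⟨zeroFieldPairLROCeiling_of_ceiling hC, ω, hω, hG, hL⟩

/-! ### Unconditional: the pair amplitude of a sourced ground state is non-negative -/

/-- **At `h > 0` every translation-invariant ground state has `Re ω(P₀^d) ≥ 0`** (`2 Re ω(P₀^d) ≥ −∂⁻E(h) ≥ 0`).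
[cite: Griffiths1966, §II] -/
theorem InfVolFermionState.IsMeanEnergyMinimiser.re_expect_localPairAt_nonneg {t' U μ h : ℝ} (hh : 0 < h)
    {ω : InfVolFermionState 2}
    (hω : ω.IsMeanEnergyMinimiser (hubbardTTPrimeSourcedInteraction 1 t' U μ dWaveFormFactor h) 1) :
    0 ≤ (ω.expect (pairRegion (insert (0 : Site 2) unitSteps) 0)
      (localPairAt (insert 0 unitSteps) dWaveFormFactor 0)).re := by
  have hIcc := hω.two_mul_re_expect_localPairAt_mem_Icc
  have hneg := leftDeriv_dWaveSourceEnergyDensityTT'_nonpos t' U μ hh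
  linarith [hIcc.1]

/-! ### Clustering at `h > 0` off the kinks (modulo the ceiling) -/

/-- **k = 0 CLUSTERING OF EVERY TRANSLATION-INVARIANT SOURCED GROUND STATE** (modulo the ceiling): at a source
`h > 0` where `E` has derivative `e'`, every ground state `ω` of `Ψ_h` has REAL pair amplitude `ω(P₀^d) = −e'/2` and
`boxLRO_N(ω) → (e'/2)²` — the finite-`h` LRO word is the response word squared. [cite: Griffiths1966, §II] -/
theorem clustering_of_ceiling {t' U μ : ℝ} (hC : TIGroundStatePairLROCeiling t' U μ) {h : ℝ} (hh : 0 < h)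
    {e' : ℝ} (hd : HasDerivAt (dWaveSourceEnergyDensityTT' t' U μ) e' h) {ω : InfVolFermionState 2}
    (hω : ω.IsMeanEnergyMinimiser (hubbardTTPrimeSourcedInteraction 1 t' U μ dWaveFormFactor h) 1) :
    ω.expect (pairRegion (insert (0 : Site 2) unitSteps) 0) (localPairAt (insert 0 unitSteps) dWaveFormFactor 0) =
        ((-e' / 2 : ℝ) : ℂ) ∧
      ∀ ε : ℝ, 0 < ε → ∀ᶠ N : ℕ in atTop,
        |(((N : ℂ) ^ 4)⁻¹ * ∑ x ∈ halfOpenBox 2 N, ∑ y ∈ halfOpenBox 2 N, ω.dWavePairCorr x y).re -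
          (e' / 2) ^ 2| ≤ ε := by
  set a : ℂ := ω.expect (pairRegion (insert (0 : Site 2) unitSteps) 0)
    (localPairAt (insert 0 unitSteps) dWaveFormFactor 0) with ha
  have hR : derivWithin (dWaveSourceEnergyDensityTT' t' U μ) (Ioi h) h = e' :=
    hd.hasDerivWithinAt.derivWithin (uniqueDiffWithinAt_Ioi h)
  have hLft : derivWithin (dWaveSourceEnergyDensityTT' t' U μ) (Iio h) h = e' :=
    hd.hasDerivWithinAt.derivWithin (uniqueDiffWithinAt_Iio h)
  have hre : a.re = -e' / 2 := by
    have := hω.two_mul_re_expect_localPairAt_eq_of_hasDerivAt hd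
    rw [← ha] at this
    linarith
  -- upper bound on ‖a‖² from the box-average bound and the ceiling
  have hnorm : ‖a‖ ^ 2 ≤ (e' / 2) ^ 2 := by
    refine le_of_forall_pos_le_add fun ε hε => ?_
    have hev := hC hh.le hω ε hε
    obtain ⟨N, hN⟩ := (hev.and (eventually_ne_atTop 0)).exists
    have hL0 := InfVolFermionState.IsTranslationInvariant.norm_expect_localPairAt_sq_le_re_boxAverage_pairCorr
      hω.1 (insert (0 : Site 2) unitSteps) dWaveFormFactor hN.2
    rw [← ha] at hL0
    rw [hR] at hN
    exact hL0.trans hN.1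
  have him : a.im = 0 := by
    have hsq : ‖a‖ ^ 2 = a.re ^ 2 + a.im ^ 2 := by
      rw [Complex.sq_norm, Complex.normSq_apply]; ring
    have : a.im ^ 2 ≤ 0 := by
      have h2 : a.re ^ 2 = (e' / 2) ^ 2 := by rw [hre]; ring
      nlinarith [hnorm, hsq, h2, sq_nonneg a.im]
    exact pow_eq_zero_iff (n := 2) (by norm_num) |>.1 (le_antisymm this (sq_nonneg _))
  refine ⟨?_, fun ε hε => ?_⟩
  · apply Complex.ext
    · rw [hre, Complex.ofReal_re]
    · rw [him, Complex.ofReal_im]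
  · have hfloor := sourcedGroundStatePairLROFloor_holds t' U μ hh hω
    filter_upwards [hC hh.le hω ε hε, eventually_ne_atTop 0] with N hN hN0
    have hlo := hfloor hN0
    rw [hLft] at hlo
    rw [hR] at hN
    rw [abs_le]
    constructor <;> linarith

end Literature.MathematicalPhysics.QuantumLattice
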